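import Summits.Schanuel.Schanuel.Theorems.ZilberEacParamSurfaceCurvedReal
import Summits.Schanuel.Schanuel.Theorems.ZilberEacParamFibreCurveSubleadingComplete
import Summits.Schanuel.Schanuel.Theorems.ZilberEacParamSurfaceEqualDeg
import HarnessLib

/-!
# Polynomially parametrised base curves, XXXVI: EVERY surface of Mantova–Masser's case over a
# CURVED REAL LINE (`deg g₀ = deg g₁ ≥ 2`, real irrational leading ratio, non-proportional
# sub-leading coefficients) has Zariski-dense exponential points

HONEST FRAMING.  Cell `pub-schanuel` (Zilber's Exponential-Algebraic Closedness, case ladder;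
host summit Schanuel), seat 2, gen 20.  Assembly: non-split `Q` (two `y₁`-degrees) over a curved
real line is file XXXV; `Q ∈ ℂ[t, y₀]` with two `y₀`-degrees is the vanishing-phase theorem of
file XXXI with `d = n` (the phase `Re(λ i) = 0` vanishes, the sub-leading condition is the
curvature condition); the trichotomy (file XXII) and the dictionary (file XXIV) give
**`unprojectedDense_of_mmCase_of_base_eq_curvedReal`**: every `W ⊆ ℂ² × ℂ²` in Mantova–Masser's
case (dim-π-S-1-free) whose base curve is `{(g₀(t), g₁(t))}` with `deg g₀ = deg g₁ = n ≥ 2`,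
`λ = lc(g₁)/lc(g₀) ∈ ℝ ∖ ℚ` and `lc(g₀)(g₁)_{n-1} ≠ lc(g₁)(g₀)_{n-1}` has Zariski-dense exponential
points — e.g. EVERY `W` of the case over `(x₁ - √2 x₀)² = x₀`; and the MASTER CAPSTONE
`unprojectedDense_of_mmCase_of_base_eq_paramCurve_master` collecting all regimes of gens 19–20 over
polynomial curves with `deg g₀, deg g₁ ≥ 2`.  Compare gens 10–18: over the
STRAIGHT real line `x₁ = √2 x₀` the question was decided family by family with rotating/rescaled
windows; the curvature term makes the whole base curve uniformly decidable.  What stays OPEN: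
rational `λ` (unimodular reduction to unequal degrees), straight real lines in general, curved real
lines with proportional sub-leading coefficients (higher orders), general algebraic curves;
Fib(3,2); EC(3,2).  Mantova–Masser's question is OPEN in general (PLMS 2024 §1 p. 5); NOT
Schanuel's conjecture (neither used nor implied; EAC ⇏ SC).
-/

noncomputable section

open Filter Topology Set Complex MvPolynomial
open Literature.NumberTheory.Transcendental Literature.ModelTheory.Zilber
open Literature.ModelTheory.ExponentialFields

set_option linter.dupNamespace false

namespace Summit.Schanuel.Schanuel.Theorems

section Main

variable (g₀ g₁ : Polynomial ℂ) {Q : MvPolynomial (Fin 3) ℂ}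

/-- **Complete theorem over a curved real line.**  `deg g₀ = deg g₁ = n ≥ 2`, `Im(lc₁/lc₀) = 0`,
`Re(lc₁/lc₀)` irrational, `lc₀(g₁)_{n-1} ≠ lc₁(g₀)_{n-1}`; `Q ∈ ℂ[t, y₀, y₁]` irreducible with a zero
in `(ℂˣ)²` over infinitely many `t` ⟹ `S(g; Q)` is in Mantova–Masser's case AND its exponential
points are Zariski dense. [cite: MantovaMasser2023, §1 Further remarks, p. 5 (the question, open in
general)] (new) -/
theorem unprojectedDensityQuestion_paramSurface₃_complete_of_curvedReal (hn : 2 ≤ g₀.natDegree)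
    (heq : g₁.natDegree = g₀.natDegree) (him : (g₁.leadingCoeff / g₀.leadingCoeff).im = 0)
    (hirrat : Irrational (g₁.leadingCoeff / g₀.leadingCoeff).re)
    (hsub : g₀.leadingCoeff * g₁.coeff (g₀.natDegree - 1) ≠
      g₁.leadingCoeff * g₀.coeff (g₀.natDegree - 1))
    (hirr : Irreducible Q)
    (hfib : Set.Infinite {t : ℂ | ∃ c : Fin 2 → ℂ, c 0 ≠ 0 ∧ c 1 ≠ 0 ∧
      MvPolynomial.eval ![t, c 0, c 1] Q = 0}) :
    MMCaseDimPiOneFree {w : Fin 2 ⊕ Fin 2 → ℂ | ∃ t : ℂ, w (Sum.inl 0) = g₀.eval t ∧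
        w (Sum.inl 1) = g₁.eval t ∧
        MvPolynomial.eval (Fin.cases t (fun i => w (Sum.inr i)) : Fin 3 → ℂ) Q = 0} ∧
      UnprojectedDense {w : Fin 2 ⊕ Fin 2 → ℂ | ∃ t : ℂ, w (Sum.inl 0) = g₀.eval t ∧
        w (Sum.inl 1) = g₁.eval t ∧
        MvPolynomial.eval (Fin.cases t (fun i => w (Sum.inr i)) : Fin 3 → ℂ) Q = 0} := by
  have hg₀ : 1 ≤ g₀.natDegree := by omega
  have hn1 : g₁.natDegree - 1 = g₀.natDegree - 1 := by rw [heq]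
  have hindep := paramCurve_indep_of_subleading g₀ g₁ hn heq (by rw [hn1]; exact hsub)
  have hcase := mmCase_paramSurface₃ g₀ g₁ hg₀ hindep hirr hfib
  rcases two_y1_degrees_or_y0_of_torusFibres hirr hfib with h2 | ⟨hQ2, h1⟩
  · exact ⟨hcase, unprojectedDense_paramSurface₃_of_curvedReal g₀ g₁ hn heq him hirrat hsub hirr h2⟩
  · refine ⟨hcase, unprojectedDense_paramSurface₃_of_y0_subleading g₀ g₁ hn (by omega)
      (heq ▸ dvd_rfl) ?_ ?_ hirr hQ2 h1⟩
    · rw [heq, Nat.div_self (by omega), pow_one,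
        show g₁.leadingCoeff * (I / g₀.leadingCoeff) = g₁.leadingCoeff / g₀.leadingCoeff * I by ring,
        Complex.mul_I_re, him, neg_zero]
    · rw [heq]
      intro h
      apply hsub
      have h' : (g₀.natDegree : ℂ) * (g₀.leadingCoeff * g₁.coeff (g₀.natDegree - 1)) =
          (g₀.natDegree : ℂ) * (g₁.leadingCoeff * g₀.coeff (g₀.natDegree - 1)) := by
        rw [← mul_assoc, ← mul_assoc]; exact h
      exact mul_left_cancel₀ (Nat.cast_ne_zero.2 (by omega)) h'

/-- **LITERAL CAPSTONE (curved real lines).**  Every `W ⊆ ℂ² × ℂ²` in Mantova–Masser's case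
(dim-π-S-1-free) whose base curve is `{(g₀(t), g₁(t))}` with `deg g₀ = deg g₁ = n ≥ 2`,
`lc(g₁)/lc(g₀) ∈ ℝ ∖ ℚ` and `lc(g₀)(g₁)_{n-1} ≠ lc(g₁)(g₀)_{n-1}` has Zariski-dense exponential
points. [cite: MantovaMasser2023, §1 Further remarks, p. 5 (the question, open in general)] (new) -/
theorem unprojectedDense_of_mmCase_of_base_eq_curvedReal (hn : 2 ≤ g₀.natDegree)
    (heq : g₁.natDegree = g₀.natDegree) (him : (g₁.leadingCoeff / g₀.leadingCoeff).im = 0)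
    (hirrat : Irrational (g₁.leadingCoeff / g₀.leadingCoeff).re)
    (hsub : g₀.leadingCoeff * g₁.coeff (g₀.natDegree - 1) ≠
      g₁.leadingCoeff * g₀.coeff (g₀.natDegree - 1))
    {W : Set (Fin 2 ⊕ Fin 2 → ℂ)} (hmm : MMCaseDimPiOneFree W)
    (hbase : zeroLocus ℂ (vanishingIdeal ℂ (projAdd '' (W ∩ torusLocus ℂ 2))) =
      {x : Fin 2 → ℂ | ∃ t : ℂ, x 0 = g₀.eval t ∧ x 1 = g₁.eval t}) :
    UnprojectedDense W := by
  obtain ⟨Q, hQ, hfib, rfl⟩ := exists_eq_paramSurface₃_of_mmCase g₀ g₁ (by omega) hmm hbase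
  exact (unprojectedDensityQuestion_paramSurface₃_complete_of_curvedReal g₀ g₁ hn heq him hirrat
    hsub hQ hfib).2

/-- **Mantova–Masser's question, literally, over a curved real line:**
`MMCaseDimPiOneFree W → UnprojectedDense W`. [cite: MantovaMasser2023, §1 Further remarks, p. 5
(the question, open in general)] (new) -/
theorem unprojectedDensityQuestion_of_base_eq_curvedReal (hn : 2 ≤ g₀.natDegree)
    (heq : g₁.natDegree = g₀.natDegree) (him : (g₁.leadingCoeff / g₀.leadingCoeff).im = 0)
    (hirrat : Irrational (g₁.leadingCoeff / g₀.leadingCoeff).re)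
    (hsub : g₀.leadingCoeff * g₁.coeff (g₀.natDegree - 1) ≠
      g₁.leadingCoeff * g₀.coeff (g₀.natDegree - 1))
    {W : Set (Fin 2 ⊕ Fin 2 → ℂ)}
    (hbase : zeroLocus ℂ (vanishingIdeal ℂ (projAdd '' (W ∩ torusLocus ℂ 2))) =
      {x : Fin 2 → ℂ | ∃ t : ℂ, x 0 = g₀.eval t ∧ x 1 = g₁.eval t}) :
    MMCaseDimPiOneFree W → UnprojectedDense W := fun hmm =>
  unprojectedDense_of_mmCase_of_base_eq_curvedReal g₀ g₁ hn heq him hirrat hsub hmm hbase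

end Main

/-! ## Example: every surface of the case over `(x₁ - √2 x₀)² = x₀` -/

/-- The curve `(x₁ - √2 x₀)² = x₀` is `{(t², √2 t² + t)}`. -/
theorem sqrtTwoCurve_eq_paramCurve :
    {x : Fin 2 → ℂ | (x 1 - ((Real.sqrt 2 : ℝ) : ℂ) * x 0) ^ 2 = x 0} =
      {x : Fin 2 → ℂ | ∃ t : ℂ, x 0 = (Polynomial.X ^ 2 : Polynomial ℂ).eval t ∧
        x 1 = (Polynomial.C ((Real.sqrt 2 : ℝ) : ℂ) * Polynomial.X ^ 2 + Polynomial.X :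
          Polynomial ℂ).eval t} := by
  ext x
  simp only [Set.mem_setOf_eq, Polynomial.eval_pow, Polynomial.eval_X, Polynomial.eval_add,
    Polynomial.eval_mul, Polynomial.eval_C]
  constructor
  · intro h
    exact ⟨x 1 - ((Real.sqrt 2 : ℝ) : ℂ) * x 0, h.symm, by rw [h]; ring⟩
  · rintro ⟨t, h0, h1⟩
    rw [h1, h0]; ring

/-- **Every `W` of Mantova–Masser's case whose base curve is the curved real line
`(x₁ - √2 x₀)² = x₀` has Zariski-dense exponential points** (`deg = 2 = 2`, `λ = √2 ∈ ℝ ∖ ℚ`,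
`1 · 1 ≠ √2 · 0`). [cite: MantovaMasser2023, §1 Further remarks, p. 5 (the question, open in
general)] (new) -/
theorem unprojectedDense_of_mmCase_of_base_eq_sqrtTwoCurve {W : Set (Fin 2 ⊕ Fin 2 → ℂ)}
    (hmm : MMCaseDimPiOneFree W)
    (hbase : zeroLocus ℂ (vanishingIdeal ℂ (projAdd '' (W ∩ torusLocus ℂ 2))) =
      {x : Fin 2 → ℂ | (x 1 - ((Real.sqrt 2 : ℝ) : ℂ) * x 0) ^ 2 = x 0}) :
    UnprojectedDense W := by
  rw [sqrtTwoCurve_eq_paramCurve] at hbase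
  have hd2 : (Polynomial.X ^ 2 : Polynomial ℂ).natDegree = 2 := by simp
  have hlc2 : (Polynomial.X ^ 2 : Polynomial ℂ).leadingCoeff = 1 := by simp
  refine unprojectedDense_of_mmCase_of_base_eq_curvedReal (Polynomial.X ^ 2)
    (Polynomial.C ((Real.sqrt 2 : ℝ) : ℂ) * Polynomial.X ^ 2 + Polynomial.X) (by rw [hd2])
    (by rw [hd2, natDegree_sqrtTwo_X_sq_add_X]) ?_ ?_ ?_ hmm hbase
  · rw [hlc2, leadingCoeff_sqrtTwo_X_sq_add_X]; simp
  · rw [hlc2, leadingCoeff_sqrtTwo_X_sq_add_X]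
    simpa using irrational_sqrt_two
  · rw [hd2, hlc2, leadingCoeff_sqrtTwo_X_sq_add_X]
    simp [Polynomial.coeff_X_pow, Polynomial.coeff_C_mul, Polynomial.coeff_X]

/-! ## The master capstone over polynomial curves (all regimes of gens 19–20) -/

/-- **MASTER CAPSTONE over polynomially parametrised base curves.**  Let `deg g₀, deg g₁ ≥ 2` and
assume ONE of the following regimes: (i) `deg g₀ < deg g₁` with [`deg g₀ ∤ deg g₁` or non-vanishing
phase or non-proportional sub-leading coefficients]; (ii) the mirror of (i); (iii) `deg g₀ = deg g₁`
with non-real leading ratio; (iv) `deg g₀ = deg g₁` with real irrational leading ratio and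
`lc(g₀)(g₁)_{n-1} ≠ lc(g₁)(g₀)_{n-1}` (curved real line).  Then EVERY `W ⊆ ℂ² × ℂ²` in
Mantova–Masser's case (dim-π-S-1-free) whose base curve is `{(g₀(t), g₁(t))}` has Zariski-dense
exponential points. [cite: MantovaMasser2023, §1 Further remarks, p. 5 (the question, open in
general)] (new) -/
theorem unprojectedDense_of_mmCase_of_base_eq_paramCurve_master (g₀ g₁ : Polynomial ℂ)
    (hd₀ : 2 ≤ g₀.natDegree) (hd₁ : 2 ≤ g₁.natDegree)
    (h : (g₀.natDegree < g₁.natDegree ∧ (¬ g₀.natDegree ∣ g₁.natDegree ∨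
        (g₁.leadingCoeff * (I / g₀.leadingCoeff) ^ (g₁.natDegree / g₀.natDegree)).re ≠ 0 ∨
        (g₀.natDegree : ℂ) * g₀.leadingCoeff * g₁.coeff (g₁.natDegree - 1) ≠
          (g₁.natDegree : ℂ) * g₁.leadingCoeff * g₀.coeff (g₀.natDegree - 1))) ∨
      (g₁.natDegree < g₀.natDegree ∧ (¬ g₁.natDegree ∣ g₀.natDegree ∨
        (g₀.leadingCoeff * (I / g₁.leadingCoeff) ^ (g₀.natDegree / g₁.natDegree)).re ≠ 0 ∨
        (g₁.natDegree : ℂ) * g₁.leadingCoeff * g₀.coeff (g₀.natDegree - 1) ≠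
          (g₀.natDegree : ℂ) * g₀.leadingCoeff * g₁.coeff (g₁.natDegree - 1))) ∨
      (g₁.natDegree = g₀.natDegree ∧ (g₁.leadingCoeff / g₀.leadingCoeff).im ≠ 0) ∨
      (g₁.natDegree = g₀.natDegree ∧ (g₁.leadingCoeff / g₀.leadingCoeff).im = 0 ∧
        Irrational (g₁.leadingCoeff / g₀.leadingCoeff).re ∧
        g₀.leadingCoeff * g₁.coeff (g₀.natDegree - 1) ≠
          g₁.leadingCoeff * g₀.coeff (g₀.natDegree - 1)))
    {W : Set (Fin 2 ⊕ Fin 2 → ℂ)} (hmm : MMCaseDimPiOneFree W)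
    (hbase : zeroLocus ℂ (vanishingIdeal ℂ (projAdd '' (W ∩ torusLocus ℂ 2))) =
      {x : Fin 2 → ℂ | ∃ t : ℂ, x 0 = g₀.eval t ∧ x 1 = g₁.eval t}) :
    UnprojectedDense W := by
  rcases h with ⟨hlt, hph⟩ | ⟨hgt, hph⟩ | ⟨heq, him⟩ | ⟨heq, him, hirrat, hsub⟩
  · exact unprojectedDense_of_mmCase_of_base_eq_paramCurve₂ g₀ g₁ hd₀ hlt hph hmm hbase
  · exact unprojectedDense_of_mmCase_of_base_eq_paramCurve₂_of_gt g₀ g₁ hd₁ hgt hph hmm hbase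
  · exact unprojectedDense_of_mmCase_of_base_eq_paramCurve_of_eq g₀ g₁ hd₀ heq him hmm hbase
  · exact unprojectedDense_of_mmCase_of_base_eq_curvedReal g₀ g₁ hd₀ heq him hirrat hsub hmm hbase

end Summit.Schanuel.Schanuel.Theorems
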